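import Summits.KontsevichZagierPeriods.KontsevichZagierPeriods.Theorems.HurwitzMicroSectorsNormalFormPrincipleM4PrismShuffle13
import Summits.KontsevichZagierPeriods.KontsevichZagierPeriods.Theorems.HurwitzMicroSectorsNormalFormPrincipleM4PrismShuffle22

/-!
# `NormalFormPrinciple` (stmt-KontsevichZagierPeriods-3869), line `SketchIdeator1` —
# leaf `stub_boxRigidity`, layer `M4` packages: the four shuffle relations of weight four

Pure proof file (registered sub-goal `m4_rel_shuffles4`, lead seat c9; `--supports` the crux;
layer `M4` packages of the dimension-four campaign `2[□⁴, 1/(1+xyzw)] ∼ [□⁴, 1/((1−xy)(1−xyzw))]`).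
Letters on `(0,1)`: `a(u) = 1/u`, `b(u) = 1/(1−u)`, `c(u) = 1/(1+u)`; word representations
`[x y z w] = [Δ₄, x(t₀)y(t₁)z(t₂)w(t₃)]` on the decreasing open simplex
`Δ₄ = {1 > t₀ > t₁ > t₂ > t₃ > 0}` (and likewise on `Δ₂`, `Δ₃`) are the iterated integrals, and the
interval `[(0,1), c(x₀)]` is the letter `c` itself. The Fubini PRODUCT of two such representations
(`KZ.IntegralRep.prod`, Kontsevich–Zagier §4.1) lives on a prism `Δ₂ × Δ₂ = P₂₂` or
`(0,1) × Δ₃ = P₁₃`, and the landed generic dissections `m4_prism_shuffle22`, `m4_prism_shuffle13`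
(rule (1a) iterated over the cells of the prism, each cell one coordinate permutation — rule (2) —
away from `Δ₄`) express it as the SHUFFLE PRODUCT of the two words. Specialising the letters and
collecting equal words:

* `[ab × ac] − 2[aabc] − 2[aacb] − [abac] − [acab] ∈ KZ.relations`   (`ab ш ac`);
* `[c × aab] − [aabc] − [aacb] − [acab] − [caab] ∈ KZ.relations`     (`c ш aab`);
* `[c × aac] − 2[aacc] − [acac] − [caac] ∈ KZ.relations`             (`c ш aac`);
* `[ab × ab] − 4[aabb] − 2[abab] ∈ KZ.relations`                     (`ab ш ab`).

The only work left here is to identify the domain and the integrand of the product representation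
(`IntegralRep.prod_domain`, `IntegralRep.prod_integrand_eq`) with the prism and with the product
of the letters, coordinate by coordinate.
References: M. Kontsevich, D. Zagier, *Periods* (2001), §1.2 rules (1), (2); §4.1 (products);
K. Ihara, M. Kaneko, D. Zagier, Compos. Math. 142 (2006), §1 (shuffle product).
No definitions are introduced.
-/

noncomputable section

open MeasureTheory Set
open Literature.NumberTheory.Transcendental Literature.NumberTheory.Transcendental.KZ
open Literature.ModelTheory.ExponentialFields (IsSemialgebraic)

namespace Summit.KontsevichZagierPeriods.HurwitzMicroSectors.NormalFormPrinciple.PiBox.M3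

/-- **The prism `P₂₂` is the product domain `Δ₂ × Δ₂`.** For representations `R`, `S` over the
decreasing simplex `Δ₂ = {0 < t₁ < t₀ < 1}`, the Fubini product `R × S` has domain
`P₂₂ = {0 < t₁ < t₀ < 1} × {0 < t₃ < t₂ < 1}`. [cite: KontsevichZagier2001, §4.1] -/
theorem m4u_prod22_domain (R S : IntegralRep 2)
    (hRd : R.domain = {t | 0 < t 1 ∧ t 1 < t 0 ∧ t 0 < 1})
    (hSd : S.domain = {t | 0 < t 1 ∧ t 1 < t 0 ∧ t 0 < 1}) :
    (R.prod S).domain = {t | 0 < t 1 ∧ t 1 < t 0 ∧ t 0 < 1 ∧ 0 < t 3 ∧ t 3 < t 2 ∧ t 2 < 1} := by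
  ext z
  rw [IntegralRep.prod_domain R S, IntegralRep.mem_prodDomain R S, hRd, hSd]
  show (0 < z 1 ∧ z 1 < z 0 ∧ z 0 < 1) ∧ (0 < z 3 ∧ z 3 < z 2 ∧ z 2 < 1) ↔
    0 < z 1 ∧ z 1 < z 0 ∧ z 0 < 1 ∧ 0 < z 3 ∧ z 3 < z 2 ∧ z 2 < 1
  simp only [and_assoc]

/-- **The integrand of a product of two words of length two** is the product of the four letters,
`(R × S)(t) = x(t₀) y(t₁) · (z(t₂) w(t₃))` (`IntegralRep.prod_integrand_eq`: the product
representation carries `R ⊗ S`). [cite: KontsevichZagier2001, §4.1] -/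
theorem m4u_prod22_integrand (x y z w : ℝ → ℝ) (R S : IntegralRep 2)
    (hRi : R.integrand = fun t => x (t 0) * y (t 1))
    (hSi : S.integrand = fun t => z (t 0) * w (t 1)) :
    EqOn (R.prod S).integrand (fun t => x (t 0) * y (t 1) * (z (t 2) * w (t 3)))
      (R.prod S).domain := by
  intro t _
  rw [IntegralRep.prod_integrand_eq R S, IntegralRep.prodFun_apply R S, hRi, hSi]
  rfl

/-- **The prism `P₁₃` is the product domain `(0,1) × Δ₃`.** For a representation `R` over the
interval `□¹ = (0,1)` and `S` over the decreasing simplex `Δ₃ = {0 < t₂ < t₁ < t₀ < 1}`, the Fubini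
product `R × S` has domain `P₁₃ = (0,1) × {0 < t₃ < t₂ < t₁ < 1}`.
[cite: KontsevichZagier2001, §4.1] -/
theorem m4u_prod13_domain (R : IntegralRep 1) (S : IntegralRep 3)
    (hRd : R.domain = {x | ∀ i, x i ∈ Set.Ioo (0:ℝ) 1})
    (hSd : S.domain = {t | 0 < t 2 ∧ t 2 < t 1 ∧ t 1 < t 0 ∧ t 0 < 1}) :
    (R.prod S).domain = {t | 0 < t 0 ∧ t 0 < 1 ∧ 0 < t 3 ∧ t 3 < t 2 ∧ t 2 < t 1 ∧ t 1 < 1} := by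
  ext z
  rw [IntegralRep.prod_domain R S, IntegralRep.mem_prodDomain R S, hRd, hSd]
  simp only [mem_setOf_eq, Fin.forall_fin_one, mem_Ioo]
  show (0 < z 0 ∧ z 0 < 1) ∧ (0 < z 3 ∧ z 3 < z 2 ∧ z 2 < z 1 ∧ z 1 < 1) ↔
    0 < z 0 ∧ z 0 < 1 ∧ 0 < z 3 ∧ z 3 < z 2 ∧ z 2 < z 1 ∧ z 1 < 1
  simp only [and_assoc]

/-- **The integrand of the product of the letter `c` with a word `a a w` of length three** is the
product of the four letters, `(R × S)(t) = c(t₀) · (a(t₁) a(t₂) w(t₃))`; the word integrand is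
taken in the landed `L2W3` normal form `1/t₀ · 1/t₁ · w(t₂)` and reassociated.
[cite: KontsevichZagier2001, §4.1] -/
theorem m4u_prod13_integrand (w : ℝ → ℝ) (R : IntegralRep 1) (S : IntegralRep 3)
    (hRi : R.integrand = fun x => 1 / (1 + x 0))
    (hSi : S.integrand = fun t => 1 / t 0 * 1 / t 1 * w (t 2)) :
    EqOn (R.prod S).integrand (fun t => 1 / (1 + t 0) * (1 / t 1 * (1 / t 2) * w (t 3)))
      (R.prod S).domain := by
  intro t _
  rw [IntegralRep.prod_integrand_eq R S, IntegralRep.prodFun_apply R S, hRi, hSi]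
  show 1 / (1 + t 0) * (1 / t 1 * 1 / t 2 * w (t 3)) = 1 / (1 + t 0) * (1 / t 1 * (1 / t 2) * w (t 3))
  ring

/-- **Stub (`m4_rel_shuffles4`; registered sub-goal of stmt-KontsevichZagierPeriods-3869, line
`SketchIdeator1`, layer `M4` packages).** The four shuffle relations of the dimension-four
campaign: for the interval `C1 = [(0,1), c]`, the `Δ₂` words `ab`, `ac`, the `Δ₃` words `aab`,
`aac` and word carriers on `Δ₄`,
`[ab × ac] − 2[aabc] − 2[aacb] − [abac] − [acab]`, `[c × aab] − [aabc] − [aacb] − [acab] − [caab]`,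
`[c × aac] − 2[aacc] − [acac] − [caac]`, `[ab × ab] − 4[aabb] − 2[abab]` all lie in
`KZ.relations`: each is ONE generic shuffle dissection of the product prism
(`m4_prism_shuffle22` / `m4_prism_shuffle13`: rule (1a) iterated, one coordinate permutation —
rule (2) — per cell) with the letters specialised and equal words collected.
[cite: KontsevichZagier2001, §1.2 rules (1), (2); §4.1] -/
theorem m4_rel_shuffles4 :
    ∀ (C1 : IntegralRep 1), C1.domain = {x | ∀ i, x i ∈ Set.Ioo (0:ℝ) 1} → (C1.integrand = fun x => 1 / (1 + x 0)) →
      ∀ (AB : IntegralRep 2), AB.domain = {t | 0 < t 1 ∧ t 1 < t 0 ∧ t 0 < 1} → (AB.integrand = fun t => 1 / t 0 * (1 / (1 - t 1))) →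
      ∀ (AC : IntegralRep 2), AC.domain = {t | 0 < t 1 ∧ t 1 < t 0 ∧ t 0 < 1} → (AC.integrand = fun t => 1 / t 0 * (1 / (1 + t 1))) →
      ∀ (AAB : IntegralRep 3), AAB.domain = {t | 0 < t 2 ∧ t 2 < t 1 ∧ t 1 < t 0 ∧ t 0 < 1} → (AAB.integrand = fun t => 1 / t 0 * 1 / t 1 * (1 / (1 - t 2))) →
      ∀ (AAC : IntegralRep 3), AAC.domain = {t | 0 < t 2 ∧ t 2 < t 1 ∧ t 1 < t 0 ∧ t 0 < 1} → (AAC.integrand = fun t => 1 / t 0 * 1 / t 1 * (1 / (1 + t 2))) →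
      ∀ (AABB : IntegralRep 4), AABB.domain = {t | 0 < t 3 ∧ t 3 < t 2 ∧ t 2 < t 1 ∧ t 1 < t 0 ∧ t 0 < 1} → (AABB.integrand = fun t => 1 / t 0 * (1 / t 1) * (1 / (1 - t 2)) * (1 / (1 - t 3))) →
      ∀ (ABAB : IntegralRep 4), ABAB.domain = {t | 0 < t 3 ∧ t 3 < t 2 ∧ t 2 < t 1 ∧ t 1 < t 0 ∧ t 0 < 1} → (ABAB.integrand = fun t => 1 / t 0 * (1 / (1 - t 1)) * (1 / t 2) * (1 / (1 - t 3))) →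
      ∀ (AABC : IntegralRep 4), AABC.domain = {t | 0 < t 3 ∧ t 3 < t 2 ∧ t 2 < t 1 ∧ t 1 < t 0 ∧ t 0 < 1} → (AABC.integrand = fun t => 1 / t 0 * (1 / t 1) * (1 / (1 - t 2)) * (1 / (1 + t 3))) →
      ∀ (AACB : IntegralRep 4), AACB.domain = {t | 0 < t 3 ∧ t 3 < t 2 ∧ t 2 < t 1 ∧ t 1 < t 0 ∧ t 0 < 1} → (AACB.integrand = fun t => 1 / t 0 * (1 / t 1) * (1 / (1 + t 2)) * (1 / (1 - t 3))) →
      ∀ (ABAC : IntegralRep 4), ABAC.domain = {t | 0 < t 3 ∧ t 3 < t 2 ∧ t 2 < t 1 ∧ t 1 < t 0 ∧ t 0 < 1} → (ABAC.integrand = fun t => 1 / t 0 * (1 / (1 - t 1)) * (1 / t 2) * (1 / (1 + t 3))) →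
      ∀ (ACAB : IntegralRep 4), ACAB.domain = {t | 0 < t 3 ∧ t 3 < t 2 ∧ t 2 < t 1 ∧ t 1 < t 0 ∧ t 0 < 1} → (ACAB.integrand = fun t => 1 / t 0 * (1 / (1 + t 1)) * (1 / t 2) * (1 / (1 - t 3))) →
      ∀ (CAAB : IntegralRep 4), CAAB.domain = {t | 0 < t 3 ∧ t 3 < t 2 ∧ t 2 < t 1 ∧ t 1 < t 0 ∧ t 0 < 1} → (CAAB.integrand = fun t => 1 / (1 + t 0) * (1 / t 1) * (1 / t 2) * (1 / (1 - t 3))) →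
      ∀ (AACC : IntegralRep 4), AACC.domain = {t | 0 < t 3 ∧ t 3 < t 2 ∧ t 2 < t 1 ∧ t 1 < t 0 ∧ t 0 < 1} → (AACC.integrand = fun t => 1 / t 0 * (1 / t 1) * (1 / (1 + t 2)) * (1 / (1 + t 3))) →
      ∀ (ACAC : IntegralRep 4), ACAC.domain = {t | 0 < t 3 ∧ t 3 < t 2 ∧ t 2 < t 1 ∧ t 1 < t 0 ∧ t 0 < 1} → (ACAC.integrand = fun t => 1 / t 0 * (1 / (1 + t 1)) * (1 / t 2) * (1 / (1 + t 3))) →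
      ∀ (CAAC : IntegralRep 4), CAAC.domain = {t | 0 < t 3 ∧ t 3 < t 2 ∧ t 2 < t 1 ∧ t 1 < t 0 ∧ t 0 < 1} → (CAAC.integrand = fun t => 1 / (1 + t 0) * (1 / t 1) * (1 / t 2) * (1 / (1 + t 3))) →
      (of (AB.prod AC) - (2:ℤ) • of AABC - (2:ℤ) • of AACB - of ABAC - of ACAB ∈ relations) ∧
      (of (C1.prod AAB) - of AABC - of AACB - of ACAB - of CAAB ∈ relations) ∧
      (of (C1.prod AAC) - (2:ℤ) • of AACC - of ACAC - of CAAC ∈ relations) ∧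
      (of (AB.prod AB) - (4:ℤ) • of AABB - (2:ℤ) • of ABAB ∈ relations) := by
  intro C1 hC1d hC1i AB hABd hABi AC hACd hACi AAB hAABd hAABi AAC hAACd hAACi AABB hAABBd hAABBi
    ABAB hABABd hABABi AABC hAABCd hAABCi AACB hAACBd hAACBi ABAC hABACd hABACi ACAB hACABd hACABi
    CAAB hCAABd hCAABi AACC hAACCd hAACCi ACAC hACACd hACACi CAAC hCAACd hCAACi
  refine ⟨?_, ?_, ?_, ?_⟩
  · -- `ab ш ac = abac + aabc + aacb + aabc + aacb + acab`
    have r1 : of (AB.prod AC) - of ABAC - of AABC - of AACB - of AABC - of AACB - of ACAB ∈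
        relations :=
      m4_prism_shuffle22 (fun u => 1 / u) (fun u => 1 / (1 - u)) (fun u => 1 / u)
        (fun u => 1 / (1 + u)) (AB.prod AC) ABAC AABC AACB AABC AACB ACAB
        (m4u_prod22_domain AB AC hABd hACd)
        (m4u_prod22_integrand (fun u => 1 / u) (fun u => 1 / (1 - u)) (fun u => 1 / u)
          (fun u => 1 / (1 + u)) AB AC hABi hACi)
        hABACd (hABACi ▸ fun _ _ => rfl) hAABCd (hAABCi ▸ fun _ _ => rfl)
        hAACBd (hAACBi ▸ fun _ _ => rfl) hAABCd (hAABCi ▸ fun _ _ => rfl)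
        hAACBd (hAACBi ▸ fun _ _ => rfl) hACABd (hACABi ▸ fun _ _ => rfl)
    have e : of (AB.prod AC) - (2:ℤ) • of AABC - (2:ℤ) • of AACB - of ABAC - of ACAB =
        of (AB.prod AC) - of ABAC - of AABC - of AACB - of AABC - of AACB - of ACAB := by abel
    rw [e]
    exact r1
  · -- `c ш aab = caab + acab + aacb + aabc`
    have r2 : of (C1.prod AAB) - of CAAB - of ACAB - of AACB - of AABC ∈ relations :=
      m4_prism_shuffle13 (fun u => 1 / (1 + u)) (fun u => 1 / u) (fun u => 1 / u)
        (fun u => 1 / (1 - u)) (C1.prod AAB) CAAB ACAB AACB AABC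
        (m4u_prod13_domain C1 AAB hC1d hAABd)
        (m4u_prod13_integrand (fun u => 1 / (1 - u)) C1 AAB hC1i hAABi)
        hCAABd (hCAABi ▸ fun _ _ => rfl) hACABd (hACABi ▸ fun _ _ => rfl)
        hAACBd (hAACBi ▸ fun _ _ => rfl) hAABCd (hAABCi ▸ fun _ _ => rfl)
    have e : of (C1.prod AAB) - of AABC - of AACB - of ACAB - of CAAB =
        of (C1.prod AAB) - of CAAB - of ACAB - of AACB - of AABC := by abel
    rw [e]
    exact r2
  · -- `c ш aac = caac + acac + aacc + aacc`
    have r3 : of (C1.prod AAC) - of CAAC - of ACAC - of AACC - of AACC ∈ relations :=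
      m4_prism_shuffle13 (fun u => 1 / (1 + u)) (fun u => 1 / u) (fun u => 1 / u)
        (fun u => 1 / (1 + u)) (C1.prod AAC) CAAC ACAC AACC AACC
        (m4u_prod13_domain C1 AAC hC1d hAACd)
        (m4u_prod13_integrand (fun u => 1 / (1 + u)) C1 AAC hC1i hAACi)
        hCAACd (hCAACi ▸ fun _ _ => rfl) hACACd (hACACi ▸ fun _ _ => rfl)
        hAACCd (hAACCi ▸ fun _ _ => rfl) hAACCd (hAACCi ▸ fun _ _ => rfl)
    have e : of (C1.prod AAC) - (2:ℤ) • of AACC - of ACAC - of CAAC =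
        of (C1.prod AAC) - of CAAC - of ACAC - of AACC - of AACC := by abel
    rw [e]
    exact r3
  · -- `ab ш ab = abab + aabb + aabb + aabb + aabb + abab`
    have r4 : of (AB.prod AB) - of ABAB - of AABB - of AABB - of AABB - of AABB - of ABAB ∈
        relations :=
      m4_prism_shuffle22 (fun u => 1 / u) (fun u => 1 / (1 - u)) (fun u => 1 / u)
        (fun u => 1 / (1 - u)) (AB.prod AB) ABAB AABB AABB AABB AABB ABAB
        (m4u_prod22_domain AB AB hABd hABd)
        (m4u_prod22_integrand (fun u => 1 / u) (fun u => 1 / (1 - u)) (fun u => 1 / u)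
          (fun u => 1 / (1 - u)) AB AB hABi hABi)
        hABABd (hABABi ▸ fun _ _ => rfl) hAABBd (hAABBi ▸ fun _ _ => rfl)
        hAABBd (hAABBi ▸ fun _ _ => rfl) hAABBd (hAABBi ▸ fun _ _ => rfl)
        hAABBd (hAABBi ▸ fun _ _ => rfl) hABABd (hABABi ▸ fun _ _ => rfl)
    have e : of (AB.prod AB) - (4:ℤ) • of AABB - (2:ℤ) • of ABAB =
        of (AB.prod AB) - of ABAB - of AABB - of AABB - of AABB - of AABB - of ABAB := by abel
    rw [e]
    exact r4

end Summit.KontsevichZagierPeriods.HurwitzMicroSectors.NormalFormPrinciple.PiBox.M3
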